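import Summits.HodgeConjecture.HodgeConjecture.Theses.HeckePrymWeil
import Summits.HodgeConjecture.HodgeConjecture.Theorems.WeilTenfoldsSqrtMinus11.Negative.EigenvalueSeparation
import Literature.AlgebraicGeometry.HodgeTheory.SemiregularVariationalHodge
import Literature.AlgebraicGeometry.HodgeTheory.StandardChernCharacterBetti
import Literature.AlgebraicGeometry.HodgeTheory.WeilClassesIsogenyDescent
import HarnessLib
import HarnessLib.Audit

/-!
# Line `quaternionic-norm-anchors` — crux `HeckePrymWeil.WeilTenfoldsSqrtMinus11` (stmt-HodgeConjecture-1262)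

Skeleton of the line (crux-plan, D-0027 §3.3). Route `HeckePrymWeil`, crux r4
`WeilTenfoldsSqrtMinus11` = "on every complex abelian TENFOLD `A` with an endomorphism `φ`,
`φ ≫ φ = -11` (`K = ℚ(√-11) ↪ End⁰ A`), every rational `(5,5)`-class in the (complexified) Weil plane —
typed as `Eig((𝟙+φ)^*, (1+i√11)¹⁰) ⊔ Eig((𝟙+φ)^*, (1-i√11)¹⁰) ⊆ H¹⁰(A(ℂ);ℂ)` — is algebraic"
(every discriminant class `δ = det H ∈ ℚ^×/Nm K^×`; nothing is known in any component: Markman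
arXiv:2502.03415 §1, arXiv:2603.20268 §1; Disproof.lean F1: the crux is summit-hard, `¬crux → ¬HC`).

## The line (crux idea `quaternionic-norm-anchors`, merged by the triage panel with
## `odd-norm-cm-enlargement`; TRIAGE r1-1/2/3: pass ×3)

LEVER. `[ℚ(ζ₁₁):ℚ] = 10 = 2·dim/2`: inside EVERY discriminant component `𝓗_δ` (dim 25) of the
polarized `ℚ(√-11)`-Weil tenfold locus sits a compact 5-dimensional Shimura family of NORM ANCHORS —
abelian tenfolds `A₀` with an automorphism `ψ₀` of order 11 (`O_L ⊂ End A₀`, `L = ℚ(ζ₁₁) ⊃ K`) of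
`L`-signature `(1,1)⁵`, `φ₀ = g(ψ₀)` the quadratic Gauss sum (`φ₀² = -11`, `gaussSum_sq` below, PROVED);
there `End⁰ A₀ ⊇ D = (-11, u)_F`, `F = ℚ(ζ₁₁)⁺`, `δ ≡ -u` (`u ∈ ℚ_{>0}`; `D` division iff `δ ≠ -1`;
Moonen–Zarhin 1998 Crit. 2 / Rem. (1); re-derived by all three triagers), and the `K`-Weil plane is a
NORM OF DIVISOR CLASSES, `W_K ⊗ ℂ = ⊗_{a ∈ □} ∧²U_{ζᵃ} ⊕ conj ⊆ D⁵ ⊗ ℂ`. The transport object is an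
algebraic VECTOR BUNDLE `E₀` on ONE anchor, glued (Ext¹-connected, Mukai index 1) from
semi-homogeneous bundles of slopes `n_t θ + μ(λ_t)`, `λ_t ∈ L`, whose Chern character is PURE —
`ch(E₀) ∈ ⊕_k ℚ θ₀ᵏ ⊕ W_K` with NON-ZERO `W_K`-part (the card's Gauss-period DESIGN over `ℚ(ζ₁₁)`: the
`θᵏ ε_S`-coefficients vanish for the 90 bad zero-sum `S ⊂ (ℤ/11)^×`, 12 Galois orbits) — and
SEMIREGULAR. Then Buchweitz–Flenner / Pridham / Perry (arXiv:2604.00511 Thm 1.1 (2), global over a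
complex variety) make the flat continuation of `ch(E₀)` — i.e. `Σ aₖ θᵏ + u`, `u` a Weil class —
ALGEBRAIC ON EVERY FIBRE of the universal polarized Weil family through the anchor; one non-zero
algebraic Weil class per fibre plus the `K`-action give all of `W_K`; `K`-isogeny invariance
(tree, PROVED) moves from the fibre to `A`.

THE SIX REGISTERED STUBS (`theorem stub_<name> : <Statement> := by sorry`; the statements are the
`def <Statement> : Prop` of §2; sizes and "why true" in their docstrings and in `Lines/….md`):
* `stub_weilPlaneTyping` — TYPING BRIDGE (M): for `dim A = 10`, `φ² = -11`, the crux's literal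
  `(𝟙+φ)^*`-eigenspaces lie in the tree's simultaneous-eigenclass Weil lines
  `weilClassesPlus/Minus A φ 5 11` (`H¹⁰ = ∧¹⁰H¹` + the LANDED separation `weil11_mixed_ne_plus/minus`).
* `stub_chernCharacterOnBetti` — CONSTRUCTION (L, formal): an instance of the tree's hypothesis
  structure `StandardChernCharacterBetti` (Chern character on `H²ⁱ(X(ℂ);ℂ)` compatible with the real
  Atiyah class; Fulton §15.1, Voisin I Thm 11.23, BF 2003 §4).
* `stub_oneClassSuffices` — ONE CLASS SUFFICES (M/L; Lieberman / "K acts by isogenies", Markman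
  2509.23079 p. 2): on a tenfold with `ψ² = -11`, one non-zero rational algebraic Weil class makes
  every rational `(5,5)` Weil class algebraic.
* `stub_anchoredWeilFamilies` — ANCHORS IN EVERY COMPONENT, AS AN ALGEBRAIC FAMILY (L/XL, classical:
  Landherr + the δ-census + PEL Shimura varieties with neat level + Baily–Borel + universal family +
  trivial monodromy of `W_K` on the `SU`-cover): every Weil-type `(A, φ)` is `K`-isogenous to a fibre
  `B` of a smooth projective family of abelian tenfolds over a smooth integral quasi-projective base
  whose fibre at another point is a NORM ANCHOR `(A₀, ψ₀, φ₀, θ₀)` (`IsNormAnchor`), carrying FLAT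
  rational Hodge sections through every `Σ aₖ θ₀ᵏ + u`, `u ∈ W_K(A₀)`.
* `stub_anchorPurePresentation` — THE BET (XL, open; hardest): on every norm anchor and for every
  standard Chern character theory there is a finite locally free `{0,1}`-semiregular `E₀` with
  `chₖ(E₀) = aₖ θ₀ᵏ` (`k ≠ 5`) and `ch₅(E₀) = a₅ θ₀⁵ + u`, `u ≠ 0` a rational Weil class.
* `stub_semiregularVariationalHodge` — THE ENGINE (XL, citable): Perry 2026 Thm 1.1 (2) ⊇ BF 2003
  Thm 5.1 / Pridham 2012 / Bandiera–Lepri–Manetti + CDK–Baire spreading, specialised to the tree's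
  real carriers for families of TENFOLDS (the tree's named fact
  `Perry2026_semiregular_remainsAlgebraic` at `n = 10`, with the anchor fibre named through an iso).
The composition `WeilTenfoldsSqrtMinus11_of` (no `sorry`) concludes the crux BY NAME from the six
`Registered.stub_*` aliases; the PROVED tree lemma
`mem_algebraicClasses_of_isogeny_of_mem_weilClassesOf` (van Geemen 3.6–3.7) is the last step.

## Disproof used (`Cruxes/WeilTenfoldsSqrtMinus11/Disproof.lean`, cdisprove cycle 1, READ 2026-08-16)

* F1 `not_hodgeConjecture_of_not` (`¬crux → ¬HC`): no stub can be "known false" short of ¬HC on an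
  abelian variety; the line is constructive and every stub is either infrastructure (typing, Chern
  character), classical (one class, families), a published engine, or the open construction.
* §B load-bearing analysis: `WithoutHodgeType` FALSE (`E¹⁰` CM witness) ⇒ `hhodge` must be used —
  it is: `IsOfHodgeType (5,5)` is a hypothesis of `OneClassSuffices`, of the Weil-type witness consumed
  by `AnchoredWeilFamilies` (a non-zero rational `(5,5)` class in the plane = `A` of Weil type
  `(5,5)`, which is what places `A` in a polarized Weil component `𝓗_δ`; for the CM `E¹⁰` of
  signature `(10,0)` no such family with `(5,5)` flat sections exists and the stub is not invoked
  because its witness hypothesis fails), and of the isogeny descent. `WithoutRat ≡ crux`: consistent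
  (`IsRationalClass` is kept everywhere; the flat sections are rational by `locusOfHodgeClasses`).
  `WithoutDim`, `WithoutPhi`, `WithoutWeilPlane`: only carve the sector — respected.
* §C typing/tightness (LANDED, `Theorems/WeilTenfoldsSqrtMinus11/Negative/EigenvalueSeparation`,
  p73707, imported here): `weil11_plus_ne_minus` is USED below (`disjoint_litPlus_litMinus`: the
  crux's two literal eigenspaces meet in `0`, so `c = c₊ + c₋` is unique), and
  `weil11_mixed_ne_plus/minus` are exactly the arithmetic half of `stub_weilPlaneTyping` (the other
  half is `H¹⁰(A) = ∧¹⁰H¹`, not in tree). No stub is an instance of a landed Negative lemma (they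
  refute nothing about tenfolds; `not_separation_all_p` concerns `p = 3`, excluded here: `p = 11`).
* SCOPE REMARK "crux = every discriminant class δ; a `(11,2)`-only or `δ = -1`-only line cannot close
  the item": honoured — `AnchoredWeilFamilies` is stated for EVERY Weil-type `(A, φ)` (anchors exist
  in every `δ = -u`, `u ∈ ℚ_{>0}`: triage r1-1/2/3 re-derivations of the transfer determinant
  `det Tr_{L/K}⟨1,-u⟩ = -u⁵ (det T)² ≡ -u`).
* Natural strengthening S2 "`W_K ⊆ D⁵`" is FALSE on the general member (Weil 1977): no stub claims a
  divisor-polynomial representative anywhere but implicitly at the anchor (where `B¹` has rank 15 and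
  `W_K ⊂ D⁵` honestly); what is transported is `ch` of a deformed BUNDLE, not a divisor polynomial.
* `ledger negatives --problem HodgeConjecture` (2 entries: ELineTransport 22×22 matrix identity,
  DerivedTorelliFermat K3 exhaustion): unrelated; no stub restates them.
-/

noncomputable section

open CategoryTheory AlgebraicGeometry
open Literature.AlgebraicGeometry.Motives Literature.AlgebraicGeometry.HodgeTheory
open Literature.AlgebraicTopology.SingularHomology
open Summit.HodgeConjecture.HodgeConjecture.Theorems.WeilTenfoldsSqrtMinus11.Negative

namespace Summit.HodgeConjecture.HodgeConjecture.Cruxes.WeilTenfoldsSqrtMinus11.QuaternionicNormAnchors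

/-! ## §1 Notation (transparent definitions over the tree's real carriers) -/

/-- The crux's literal `σ`-Weil eigenspace: `Eig((𝟙+φ)^* on H¹⁰(A(ℂ);ℂ), (1+i√11)¹⁰)`. -/
abbrev litPlus (A : AbelianVariety ℂ) (φ : A ⟶ A) : Submodule ℂ (complexBetti A.X (2 * 5)) :=
  Module.End.eigenspace (complexBetti.map (𝟙 A + φ).hom.hom.hom (2 * 5)).hom
    ((1 + Complex.I * (Real.sqrt (11 : ℝ) : ℂ)) ^ 10)

/-- The crux's literal `σ̄`-Weil eigenspace: `Eig((𝟙+φ)^* on H¹⁰(A(ℂ);ℂ), (1-i√11)¹⁰)`. -/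
abbrev litMinus (A : AbelianVariety ℂ) (φ : A ⟶ A) : Submodule ℂ (complexBetti A.X (2 * 5)) :=
  Module.End.eigenspace (complexBetti.map (𝟙 A + φ).hom.hom.hom (2 * 5)).hom
    ((1 - Complex.I * (Real.sqrt (11 : ℝ) : ℂ)) ^ 10)

/-- The quadratic GAUSS SUM in an endomorphism `z` (intended: an automorphism of order 11):
`g(z) = Σ_{k=1}^{10} (k|11) zᵏ`, squares mod 11 = `{1,3,4,5,9}`; in the ring `End A`
(multiplication = composition). Verbatim the ideator's `IdeatorTwoSketch.gaussSum`. -/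
def gaussSum (A : AbelianVariety ℂ) (z : CategoryTheory.End A) : CategoryTheory.End A :=
  z + z ^ 3 + z ^ 4 + z ^ 5 + z ^ 9 - z ^ 2 - z ^ 6 - z ^ 7 - z ^ 8 - z ^ 10

/-- **`L`-signature `(1,1)` at every place of `L = ℚ(ζ₁₁)`**, typed through pull-backs only: for
every primitive 11th root of unity `u`, the `(1+u)²`-eigenclasses of `(𝟙+ψ)^*` on `H²(A(ℂ);ℂ)` —
given `H² = ∧²H¹` this is exactly the line `∧²U_u` (`U_u` the `u`-eigenspace of `ψ^*` on `H¹`; the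
mixed summands `U_v ⊗ U_w`, `v ≠ w`, `vw = u²`, have `(1+v)(1+w) ≠ (1+u)²`: triage r1-1/2 check A,
kit jobs j010218 §A / j010200 A, 0 off-diagonal solutions) — lie in the `ℂ`-span of the RATIONAL
`(1,1)`-classes, i.e. are divisorial. Equivalent to `dim U_u^{1,0} = dim U_u^{0,1} = 1` for all `u`
(Shimura's degenerate type-IV case; then `End⁰ A ⊇ D ⊃ L`, Moonen–Zarhin 1998 Rem. (1)). -/
def SignatureOneOne (A : AbelianVariety ℂ) (ψ : A ⟶ A) : Prop :=
  ∀ u : ℂ, u ^ 11 = 1 → u ≠ 1 →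
    Module.End.eigenspace (complexBetti.map (𝟙 A + ψ).hom.hom.hom 2).hom ((1 + u) ^ 2) ≤
      Submodule.span ℂ {b : complexBetti A.X 2 | IsRationalClass b ∧ IsOfHodgeType 10 A.X 2 1 1 b}

/-- **NORM ANCHOR datum** `(A₀, ψ₀, φ₀, θ₀)` — the interface between `AnchoredWeilFamilies` (which
DELIVERS one in the component of every Weil-type tenfold) and `AnchorPurePresentation` (which must
build the object on EVERY one): an abelian TENFOLD `A₀`; an endomorphism `ψ₀` with `ψ₀¹¹ = 𝟙` and
vanishing norm `Σ_{k<11} ψ₀ᵏ = 0` (an action of `O_L = ℤ[ζ₁₁]`, no eigenvalue `1` on `H¹`); the crux's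
endomorphism IS the Gauss sum, `φ₀ = g(ψ₀)` (so `φ₀ ≫ φ₀ = -11`, `gaussSum_sq`); `L`-signature
`(1,1)⁵` (`SignatureOneOne`); and a `ψ₀`-INVARIANT HYPERPLANE CLASS `θ₀` (`ψ₀^* θ₀ = θ₀`: the
polarization is `L`-compatible, Rosati = complex conjugation on `L`; `θ₀ = ι^* a` for a projective
embedding `ι` and a non-zero rational class `a` of `H²(ℙᴺ)`, i.e. `± q·`(very ample class) — the sign
is immaterial for the object problem, `E ↦ E^∨`). These are the quaternionic-multiplication tenfolds
`End⁰ ⊇ (-11, u)_{ℚ(ζ₁₁)⁺}` of the card, with the polarization of their Weil component. -/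
def IsNormAnchor (A₀ : AbelianVariety ℂ) (ψ₀ φ₀ : A₀ ⟶ A₀) (θ₀ : complexBetti A₀.X 2) : Prop :=
  A₀.dim = 10 ∧
  (show CategoryTheory.End A₀ from ψ₀) ^ 11 = 1 ∧
  (Finset.range 11).sum (fun k => (show CategoryTheory.End A₀ from ψ₀) ^ k) = 0 ∧
  φ₀ = gaussSum A₀ ψ₀ ∧
  SignatureOneOne A₀ ψ₀ ∧
  complexBetti.map ψ₀.hom.hom.hom 2 θ₀ = θ₀ ∧
  ∃ (emb : ProjectiveEmbedding A₀.X) (a : complexBetti (projectiveSpace emb.n ℂ) 2),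
    IsRationalClass a ∧ a ≠ 0 ∧ θ₀ = complexBetti.map emb.ι 2 a

/-! ## §2 The six stub STATEMENTS (named `Prop`s; `stub_*` below restate them verbatim) -/

/-- STUB T statement — **WEIL-PLANE TYPING BRIDGE** (infrastructure, size M). For an abelian tenfold
`A` with `φ ≫ φ = -11`, the crux's LITERAL eigenspaces `Eig((𝟙+φ)^*, (1±i√11)¹⁰) ⊆ H¹⁰` lie in the
tree's Weil lines `weilClassesPlus/Minus A φ 5 11` (simultaneous eigenclasses of all `(x·𝟙+y·φ)^*`,
`x y : ℕ`, characters `(x ± iy√11)¹⁰`; `HodgeTheory/WeilClasses`). WHY TRUE: `H¹⁰(A(ℂ);ℂ) =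
⊕_{a+b=10} ∧ᵃV₊ ⊗ ∧ᵇV₋` (`V± =` the `±i√11`-eigenspaces of `φ^*` on `H¹`, `H^• = ∧^•H¹` for a complex
torus) and `(𝟙+φ)^*` acts on the `(a,b)` summand by `(1+i√11)ᵃ(1-i√11)ᵇ`, which differs from
`(1+i√11)¹⁰` unless `b = 0` and from `(1-i√11)¹⁰` unless `a = 0` — EXACTLY the LANDED
`weil11_mixed_ne_plus` / `weil11_mixed_ne_minus` (Disproof §C); on `∧¹⁰V₊` every `(x𝟙+yφ)^*` acts
by `(x+iy√11)¹⁰`. Lean gap: the cohomology ring of a complex torus / Künneth for `complexBetti` (the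
same gap as the route's `WeilDescending`, item 1263, and as every sibling Weil line). The converse
inclusion is trivial (`x = y = 1`) and not needed. -/
def WeilPlaneTyping : Prop :=
  ∀ (A : AbelianVariety ℂ) (φ : A ⟶ A), A.dim = 10 → φ ≫ φ = -((11 : ℤ) • 𝟙 A) →
    litPlus A φ ≤ weilClassesPlus A φ 5 11 ∧ litMinus A φ ≤ weilClassesMinus A φ 5 11

/-- STUB C statement — **A STANDARD CHERN CHARACTER ON THE REAL CARRIERS EXISTS** (construction,
size L, formal): an instance of the tree's hypothesis structure `StandardChernCharacterBetti`
(`HodgeTheory/StandardChernCharacterBetti`: `chᵢ(E) ∈ H²ⁱ(X(ℂ);ℂ)` of algebraic vector bundles with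
additivity, functoriality, normalisations, rationality, algebraicity + span on smooth projective `X`,
AND the Hodge realisation `H¹(Ω¹) ↪ H²` carrying `Tr(-At E)` to `ch₁(E)` — "intended, and up to
`chᵢ ↦ λⁱ chᵢ` only, instance: the topological Chern character"; the compatibility with the Atiyah
class is what connects `IsZeroOneSemiregular` to `ch` in the engine). The tree records no `Nonempty`
fact on purpose (D-0026): it is a construction (splitting principle on `X(ℂ)`, Dolbeault/GAGA). -/
def ChernCharacterOnBetti : Prop :=
  Nonempty StandardChernCharacterBetti

/-- STUB 1 statement — **ONE CLASS SUFFICES** (size M/L). On an abelian tenfold `B` with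
`ψ ≫ ψ = -11`: if ONE non-zero rational class of the Weil plane `weilClassesOf B ψ 5 11` is algebraic,
then EVERY rational `(5,5)` class of the plane is (the conclusion is verbatim the `halg` hypothesis of
the tree's isogeny-descent lemma). WHY TRUE ("it suffices to prove the algebraicity of one non-zero
class in `HW(A, η)`, as `K` acts via algebraic correspondences", Markman arXiv:2509.23079 p. 2;
Lieberman): `W_K := weilClassesOf ∩ H¹⁰(B, ℚ) = ∧¹⁰_K H¹(B, ℚ)` is a `K`-LINE (`dim_ℚ 2`), and
`(𝟙+ψ)^*` acts on it by `(1 ± i√11)¹⁰`, generating `K` over `ℚ` (not real: `weil11_plus_ne_minus`);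
`𝟙 + ψ` is an ISOGENY (`(𝟙+ψ)(𝟙-ψ) = 12`), hence finite flat, so `(𝟙+ψ)^*` preserves
`algebraicClasses` (`map_mem_algebraicClasses_of_flat`, in tree), rational classes and the plane
(`map_mem_weilClassesOf`); a non-zero rational `u₁` has BOTH eigencomponents non-zero (complex
conjugation fixes `u₁` and swaps the two conjugate eigenspaces of the real operator `(𝟙+ψ)^*`;
`HodgeTheory/ComplexConjugation`), so `u₁`, `(𝟙+ψ)^* u₁` span `E₊ ⊕ E₋ ∋ c`. Lean gap: the plane is
2-dimensional (`H¹⁰ = ∧¹⁰H¹` again) and conjugation on `complexBetti` commuting with pull-backs.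
Uses `IsRationalClass` essentially (Disproof §B: `WithoutRat` is only formally stronger). -/
def OneClassSuffices : Prop :=
  ∀ (B : AbelianVariety ℂ) (ψ : B ⟶ B), B.dim = 10 → ψ ≫ ψ = -((11 : ℤ) • 𝟙 B) →
    (∃ u₁ : complexBetti B.X (2 * 5), IsRationalClass u₁ ∧ u₁ ∈ weilClassesOf B ψ 5 11 ∧ u₁ ≠ 0 ∧
      u₁ ∈ algebraicClasses B.X 5) →
    ∀ c : complexBetti B.X (2 * 5), IsRationalClass c → IsOfHodgeType (2 * 5) B.X (2 * 5) 5 5 c →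
      c ∈ weilClassesOf B ψ 5 11 → c ∈ algebraicClasses B.X 5

/-- STUB 2 statement — **ANCHORED WEIL FAMILIES: every Weil-type tenfold lies, up to `K`-isogeny, in
a smooth projective family through a NORM ANCHOR, along which the polarization powers and the Weil
classes are flat rational Hodge sections** (size L/XL to formalise; classical, no open mathematics).
Given `(A, φ)`, `dim A = 10`, `φ² = -11`, and a NON-ZERO rational `(5,5)` class in its Weil plane
(the Weil-type witness: `A` is of `K`-Weil type `(5,5)`), there are: a smooth projective family
`π : 𝒳 → S` of relative dimension 10 over a smooth, integral, quasi-projective `ℂ`-scheme; points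
`s₀, s₁ ∈ S(ℂ)`; a norm anchor `(A₀, ψ₀, φ₀, θ₀)` (`IsNormAnchor`) with `X_{s₀} ≅ A₀`; an abelian
tenfold `(B, ψ_B)`, `ψ_B² = -11`, with a Hodge model, `X_{s₁} ≅ B`, and a `K`-ISOGENY PAIR
`f : A → B` (flat), `g : B → A` (`g ≫ φ = ψ_B ≫ g`, `f ≫ g = m·𝟙`, `m ≥ 1`); and, for every
coefficient vector `a : ℕ → ℚ` and every rational `u ∈ weilClassesOf A₀ φ₀ 5 11`, FLAT sections
`w_k` of `R^{2k}π_*ℂ` (continuous sections of the étalé spaces `FiberClass π (2k)`) with values in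
the locus of Hodge classes (rational, type `(k,k)`) everywhere, equal at `s₀` to `aₖ θ₀ᵏ`
(`k ≠ 5`) resp. `a₅ θ₀⁵ + u`, and at `s₁` (degree 10) to `u₁ + d` with `u₁` a rational class of the
Weil plane of `(B, ψ_B)`, NON-ZERO when `u ≠ 0`, and `d` ALGEBRAIC on `B`.
WHY TRUE: (i) δ-CENSUS + LANDHERR: `(H₁(A,ℚ), H_A)` (`H_A` the `K`-hermitian form of a `K`-compatible
polarization, van Geemen 5.2 (1)) has signature `(5,5)` and some `δ = det H = -u`, `u ∈ ℚ_{>0}`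
(signature `(5,5)` forces `det H < 0`, vG 4.14); `V := L²`, `L = ℚ(ζ₁₁)`, with `H' = Tr_{L/K}⟨1,-u⟩`
has signature `(5,5)` and `det ≡ -u⁵(det T)² ≡ -u` (triage r1-1/2/3), so `(H₁(A,ℚ), H_A) ≅ (V, H')`
as `K`-hermitian spaces (Landherr: dim, signature, discriminant classify). (ii) LATTICE CHANGE: under
this isometry `Λ_A = H₁(A,ℤ)` is commensurable with the `O_L`-lattice `Λ_L = O_L²`; the complex torus
`B := (Λ_L, J_A)` (same complex structure) is an abelian variety `K`-isogenous to `A` (`f`, `g`,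
`f ≫ g = m`, Milne §8) — `B` need not have an `L`-action, but (iii) the connected PEL Shimura variety
`S = Γ\SU(V,H')(ℝ)/K_∞`, `Γ ⊂ SU(H')(ℚ) ∩ Stab(Λ_L)` NEAT, is a smooth, irreducible,
quasi-projective variety (Baily–Borel) with a universal polarized family of abelian tenfolds of
`K`-Weil type `(5,5)` (fine moduli for neat level, Mumford GIT §7; pull back from the `U`-level), whose
fibre at the period point `s₁` of `J_A` is `B`, and whose fibres at the (non-empty, 5-dimensional) set
of `L`-LINEAR period points of `L`-signature `(1,1)⁵` (`∏_ν` discs `⊂ D`) are norm anchors: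
`Λ_L` is `O_L`-stable, so `ζ₁₁` acts as an AUTOMORPHISM `ψ₀`, `Σψ₀ᵏ = 0` on `H¹` (no invariants),
`g(ζ₁₁) = ±√-11` in `L` (choose the generator `ζ₁₁^a` with the right sign so `g(ψ₀) = φ₀ =` the
family's `√-11`), and the family's polarization `E = Im H'` is `L`-compatible (`H' = Tr_{L/K}Ψ`), so
`ψ₀^* θ₀ = θ₀` for `θ₀ = c₁` of a relatively very ample power restricted to `X_{s₀}`, a hyperplane
class. (iv) FLATNESS: `θᵏ|_{X_s}` is the restriction of the global class `Θᵏ`, `Θ ∈ H²(𝒳(ℂ))`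
(`globalSection`, continuous by `continuous_globalSection`); the Weil local system
`W = ∧¹⁰_K R¹π_*ℚ` has TRIVIAL monodromy on the `SU`-level (`det_K = 1`), so every
`u ∈ W_K(A₀) = (weilClassesOf A₀ φ₀ 5 11) ∩ H¹⁰(A₀,ℚ)` extends to a global flat section, non-zero
everywhere iff `u ≠ 0`, with values in the Weil plane of each fibre (the `K`-action is global), in
particular in `weilClassesOf B ψ_B 5 11` at `s₁` (`ψ_B =` the family's `√-11`, which `g`, `f`
intertwine with `φ`); every fibre is of Weil type `(5,5)`, so these values are rational `(5,5)`
classes, and `θᵏ` is rational `(k,k)`: all sections lie in `locusOfHodgeClasses`; `d = a₅ θ_B⁵` is the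
class of a codimension-5 linear section of `B`, algebraic. Lean gaps: no moduli/universal families of
abelian varieties, no Riemann form on `H₁(A(ℂ))`, no Ehresmann (flat = continuous) in the tree — all
classical. [van Geemen LNM 1594 §5 (5.2–5.11, 4.14); Landherr 1936; Deligne–Milne LNM 900 §4;
Baily–Borel 1966; Mumford GIT §7.3; Moonen–Zarhin 1998 Crit. 2; Milne 1986 §8.] -/
def AnchoredWeilFamilies : Prop :=
  ∀ (A : AbelianVariety ℂ) (φ : A ⟶ A), A.dim = 10 → φ ≫ φ = -((11 : ℤ) • 𝟙 A) →
    (∃ c : complexBetti A.X (2 * 5), IsRationalClass c ∧ IsOfHodgeType 10 A.X (2 * 5) 5 5 c ∧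
      c ∈ weilClassesOf A φ 5 11 ∧ c ≠ 0) →
    ∃ (𝒳 S : SchemeOver ℂ) (π : 𝒳 ⟶ S),
      IsSmoothProjectiveFamily π 10 ∧ IsQuasiProjectiveOver S ∧
      AlgebraicGeometry.IsIntegral S.left ∧ _root_.AlgebraicGeometry.Smooth S.hom ∧
      ∃ (s₀ s₁ : ComplexPoints S)
        (A₀ : AbelianVariety ℂ) (ψ₀ φ₀ : A₀ ⟶ A₀) (θ₀ : complexBetti A₀.X 2)
        (e₀ : fiberOver π s₀ ≅ A₀.X)
        (B : AbelianVariety ℂ) (ψB : B ⟶ B) (e₁ : fiberOver π s₁ ≅ B.X)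
        (f : A ⟶ B) (g : B ⟶ A) (m : ℕ),
        IsNormAnchor A₀ ψ₀ φ₀ θ₀ ∧
        B.dim = 10 ∧ ψB ≫ ψB = -((11 : ℤ) • 𝟙 B) ∧ Nonempty (HodgeModel (2 * 5) B.X) ∧
        AlgebraicGeometry.Flat f.hom.hom.hom.left ∧ g ≫ φ = ψB ≫ g ∧ 0 < m ∧ f ≫ g = m • 𝟙 A ∧
        ∀ (a : ℕ → ℚ) (u : complexBetti A₀.X (2 * 5)),
          IsRationalClass u → u ∈ weilClassesOf A₀ φ₀ 5 11 →
          ∃ w : ∀ (k : ℕ) (s : ComplexPoints S), complexBetti (fiberOver π s) (2 * k),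
            (∀ k, Continuous fun s => (⟨s, w k s⟩ : FiberClass π (2 * k))) ∧
            (∀ k s, (⟨s, w k s⟩ : FiberClass π (2 * k)) ∈ locusOfHodgeClasses π 10 k) ∧
            (∀ k, k ≠ 5 →
              w k s₀ = complexBetti.map e₀.hom (2 * k) (((a k : ℚ) : ℂ) • cupPowTwo θ₀ k)) ∧
            w 5 s₀ = complexBetti.map e₀.hom (2 * 5) (((a 5 : ℚ) : ℂ) • cupPowTwo θ₀ 5 + u) ∧
            ∃ (u₁ d : complexBetti B.X (2 * 5)),
              IsRationalClass u₁ ∧ u₁ ∈ weilClassesOf B ψB 5 11 ∧ (u ≠ 0 → u₁ ≠ 0) ∧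
              d ∈ algebraicClasses B.X 5 ∧
              w 5 s₁ = complexBetti.map e₁.hom (2 * 5) (u₁ + d)

/-- STUB 3 statement — **PURE SEMIREGULAR PRESENTATION AT EVERY NORM ANCHOR** (THE BET; size XL,
OPEN — the card's `C⁺`, "one object on one explicit QM tenfold per δ", here uniformly over all
anchors). For every standard Chern character theory `C` and every norm anchor `(A₀, ψ₀, φ₀, θ₀)`
there is a finite locally free `𝒪`-module `E₀` on `A₀` which is `{0,1}`-SEMIREGULAR
(`(σ₀, σ₁) = (Tr, Tr(At ∘ ·))` injective on `Ext²(E₀, E₀)`, the tree's CONSTRUCTED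
`IsZeroOneSemiregular` — it implies Buchweitz–Flenner/Perry semiregularity) and whose Chern character
is PURE with NON-ZERO WEIL PART: `chₖ(E₀) = aₖ θ₀ᵏ` for `k ≠ 5` and `ch₅(E₀) = a₅ θ₀⁵ + u` with
`u ≠ 0` a rational class of the Weil plane `weilClassesOf A₀ φ₀ 5 11`.
WHY PLAUSIBLY TRUE / THE WORK (card §Lever, §Transfer; census "Recommended next"): on the anchor
`NS(A₀) ⊗ ℚ ⊇ F·θ₀ ⊕ μ(L)` (rank 15), `μ(λ) = Σ_a σ_a(λ) ε_a`, `ε_a` spanning the divisorial lines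
`∧²U_{ζᵃ}` (`SignatureOneOne`); a bundle glued from semi-homogeneous bundles of slopes
`n_t θ₀ + μ(λ_t)` has `ch = Σ_t s_t e^{n_t θ₀} ∏_a (1 + σ_a(λ_t) ε_a)`, which is PURE — no `θᵏ ε_S`
with `S ∉ {∅, □, ⊠, all}`, where `ε_□`, `ε_⊠` span `W_K ⊗ ℂ = ⊗_{a∈□}∧²U_{ζᵃ} ⊕ conj`, `θ₀ᵏ ε_□ = 0`
for `k ≥ 1` (charge), `ε_all ∈ ℚ θ₀¹⁰` — iff the weighted partial norms
`Σ_t s_t n_tᵏ ∏_{a∈S} σ_a(λ_t)` vanish on the bad `S`: the GAUSS-PERIOD DESIGN over `ℚ(ζ₁₁)` (for a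
`ψ₀`-invariant presentation only the 90 zero-sum `S`, 12 Galois orbits, remain; `□` is zero-sum free;
solvable for large `r` by monomial independence — triage r1-1/2); `u ≠ 0` is the `ε_□`-coefficient
`Σ s_t ∏_{a∈□} σ_a(λ_t) ≠ 0` (+ conj; `ch` is rational so the `W`-part is a rational Weil class). The
OPEN CORE is to realise such a design by an Ext¹-CONNECTED gluing (pairwise Mukai indices
`index(mθ₀ + μ(λ)) = #{a : |σ_a(λ)| > m c_a} = 1`, so the constituents have `Ext¹ ≠ 0` and the
extension is a non-split VECTOR BUNDLE — direct sums and filtered-by-line-bundle objects never deform,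
census B6/B7/B10) which is SEMIREGULAR; `{0,1}`-semiregularity is the typable (stronger) form: budget
`dim Ext²(E₀,E₀) ≤ h^{0,2} + h^{1,3} = 45 + 1200`. WHY IT MIGHT FAIL: purity may force all pairwise
indices into `{0,5,10} ∪ {≥ 2}` (no Ext¹-connected pure presentation: card falsifier F1, kit-sized
no-glue search recommended FIRST); or `(σ₀,σ₁)` is not injective although `σ` is (then RESHAPE: replace
`IsZeroOneSemiregular` by full semiregularity once `Ω^q`-traces exist, `defn-HodgeSheavesOmega`, and
weaken STUB 4 in tandem — Perry/Pridham need only `σ` injective). Barrier check: evades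
`Weil1977_exceptionalHodgeClasses` at the OBJECT step (the transported class is `ch` of a deformed
bundle; at the anchor `W_K ⊂ D⁵` honestly, `B¹` of rank 15); at special anchors with extra classes the
Ext-groups of the constituents are numerically determined (non-degenerate classes), so the statement is
uniform over the 5-dimensional anchor family of each `δ`; uniformity in `u` (infinitely many `δ`,
triage r1-3) is part of the bet. [Mukai 1978 (semi-homogeneous bundles); BF 2003 Def. 4.1, §5;
Perry 2604.00511 Def. 2.4; Markman 2502.03415 §1.5 (κ-class, twisted BF on abelian varieties);
Moonen–Zarhin 1998; card quaternionic-norm-anchors §Lever/§Transfer/§Cheapest falsifier.] -/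
def AnchorPurePresentation : Prop :=
  ∀ (C : StandardChernCharacterBetti) (A₀ : AbelianVariety ℂ) (ψ₀ φ₀ : A₀ ⟶ A₀)
    (θ₀ : complexBetti A₀.X 2), IsNormAnchor A₀ ψ₀ φ₀ θ₀ →
    ∃ (E₀ : A₀.X.left.Modules) (hE₀ : IsFiniteLocallyFree E₀),
      IsZeroOneSemiregular hE₀ ∧
      ∃ (a : ℕ → ℚ) (u : complexBetti A₀.X (2 * 5)),
        IsRationalClass u ∧ u ∈ weilClassesOf A₀ φ₀ 5 11 ∧ u ≠ 0 ∧
        (∀ k : ℕ, k ≠ 5 → C.ch A₀.X E₀ k = ((a k : ℚ) : ℂ) • cupPowTwo θ₀ k) ∧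
        C.ch A₀.X E₀ 5 = ((a 5 : ℚ) : ℂ) • cupPowTwo θ₀ 5 + u

/-- STUB 4 statement — **SEMIREGULAR VARIATIONAL HODGE FOR FAMILIES OF TENFOLDS** (THE ENGINE; size XL
to formalise, CITABLE: Perry, arXiv:2604.00511 Thm 1.1 (2) with `B₀ = 0`, `E₀` a `{0,1}`-semiregular
vector bundle — "`w₀ = ch(E₀)` remains Hodge along `S`, i.e. lifts to a global section `w` of
`⊕ R^{2k}f_*ℚ(k)` ⟹ for every point `s ∈ S(ℂ)` the fiber `w_s` is algebraic", `S` a complex variety —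
= the tree's named fact `Perry2026_semiregular_remainsAlgebraic` at relative dimension 10 with the base
fibre named through an isomorphism `X_{s₀} ≅ W₀`; refereed alternative: Buchweitz–Flenner 2003 Thm 5.1
/ Pridham arXiv:1208.3111 / Bandiera–Lepri–Manetti (semiregularity annihilates obstructions: `E₀`
deforms over the germ where `ch(E₀)` stays Hodge, Artin approximation makes the deformation algebraic
over an étale neighbourhood, `ch` of the deformation is the flat continuation and is algebraic
fibrewise) + SPREADING (the set of `s` where a flat rational Hodge section is algebraic is a countable
union of closed algebraic subsets of the irreducible `S` — relative Hilbert schemes — containing a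
Euclidean open set, hence everything: CDK 1995 + Baire, as in Markman 2502.03415 §1.5). On real
carriers: for every standard Chern character theory `C`, every smooth projective family `π : 𝒳 → S`
of relative dimension 10 over a smooth integral quasi-projective `ℂ`-scheme, every family `w_k`
(`k ≥ 0`) of continuous sections of `FiberClass π (2k)` with values in `locusOfHodgeClasses π 10 k`,
every `s₀`, `W₀ ≅ X_{s₀}` and finite locally free `{0,1}`-semiregular `E₀` on `W₀` with
`w_k(s₀) = chₖ(E₀)` (transported along the iso) for all `k`: `w_k(s)` is an algebraic class of `X_s`
for every `s` and `k`. (Transport of `E₀` along the iso preserves local freeness, semiregularity and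
`ch` — `C.map_ch`; so this IS the named fact.) [cite: Perry2026Semiregularity, Thm. 1.1 (2)]
[cite: BuchweitzFlenner2003, Thm. 5.1] [cite: CattaniDeligneKaplan1995JAMS, Cor. 1.2] -/
def SemiregularVariationalHodgeTen : Prop :=
  ∀ (C : StandardChernCharacterBetti) (𝒳 S : SchemeOver ℂ) (π : 𝒳 ⟶ S),
    IsSmoothProjectiveFamily π 10 → IsQuasiProjectiveOver S → AlgebraicGeometry.IsIntegral S.left →
    _root_.AlgebraicGeometry.Smooth S.hom →
    ∀ (w : ∀ (k : ℕ) (s : ComplexPoints S), complexBetti (fiberOver π s) (2 * k)),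
      (∀ k, Continuous fun s => (⟨s, w k s⟩ : FiberClass π (2 * k))) →
      (∀ k s, (⟨s, w k s⟩ : FiberClass π (2 * k)) ∈ locusOfHodgeClasses π 10 k) →
      ∀ (s₀ : ComplexPoints S) (W₀ : SchemeOver ℂ) (e₀ : fiberOver π s₀ ≅ W₀)
        (E₀ : W₀.left.Modules) (hE₀ : IsFiniteLocallyFree E₀), IsZeroOneSemiregular hE₀ →
        (∀ k, w k s₀ = complexBetti.map e₀.hom (2 * k) (C.ch W₀ E₀ k)) →
        ∀ (s : ComplexPoints S) (k : ℕ), w k s ∈ algebraicClasses (fiberOver π s) k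

/-! ## §3 The registered stubs (the only `sorry`s of this file) -/

/-- STUB T (M, infrastructure) — see `WeilPlaneTyping`. -/
theorem stub_weilPlaneTyping : WeilPlaneTyping := by
  sorry

/-- STUB C (L, construction) — see `ChernCharacterOnBetti`. -/
theorem stub_chernCharacterOnBetti : ChernCharacterOnBetti := by
  sorry

/-- STUB 1 (M/L) — see `OneClassSuffices`. -/
theorem stub_oneClassSuffices : OneClassSuffices := by
  sorry

/-- STUB 2 (L/XL, classical) — see `AnchoredWeilFamilies`. -/
theorem stub_anchoredWeilFamilies : AnchoredWeilFamilies := by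
  sorry

/-- STUB 3 (XL, OPEN; HARDEST) — see `AnchorPurePresentation`. -/
theorem stub_anchorPurePresentation : AnchorPurePresentation := by
  sorry

/-- STUB 4 (XL, citable engine) — see `SemiregularVariationalHodgeTen`. -/
theorem stub_semiregularVariationalHodge : SemiregularVariationalHodgeTen := by
  sorry

/-! ### Name-keyed aliases of the six statements (the hypotheses of the composition; the native
skeleton audit admits `Prop` hypotheses BY NAME of a declared stub) -/
namespace Registered

/-- Alias of `WeilPlaneTyping` keyed by the registered stub name. -/
abbrev stub_weilPlaneTyping : Prop := WeilPlaneTyping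
/-- Alias of `ChernCharacterOnBetti` keyed by the registered stub name. -/
abbrev stub_chernCharacterOnBetti : Prop := ChernCharacterOnBetti
/-- Alias of `OneClassSuffices` keyed by the registered stub name. -/
abbrev stub_oneClassSuffices : Prop := OneClassSuffices
/-- Alias of `AnchoredWeilFamilies` keyed by the registered stub name. -/
abbrev stub_anchoredWeilFamilies : Prop := AnchoredWeilFamilies
/-- Alias of `AnchorPurePresentation` keyed by the registered stub name. -/
abbrev stub_anchorPurePresentation : Prop := AnchorPurePresentation
/-- Alias of `SemiregularVariationalHodgeTen` keyed by the registered stub name. -/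
abbrev stub_semiregularVariationalHodge : Prop := SemiregularVariationalHodgeTen

end Registered

/-! ## §4 Checked lemmas (no `sorry`) -/

/-- The crux's two literal eigenspaces are DISJOINT: `(1+i√11)¹⁰ ≠ (1-i√11)¹⁰` is the LANDED
`weil11_plus_ne_minus` (Disproof §C, `Theorems/…/Negative/EigenvalueSeparation`), so the decomposition
`c = c₊ + c₋` of a class of the literal Weil plane is unique. -/
theorem disjoint_litPlus_litMinus (A : AbelianVariety ℂ) (φ : A ⟶ A) :
    Disjoint (litPlus A φ) (litMinus A φ) := by
  rw [Submodule.disjoint_def]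
  intro x hx hy
  rw [Module.End.mem_eigenspace_iff] at hx hy
  have h : ((1 + Complex.I * (Real.sqrt (11 : ℝ) : ℂ)) ^ 10 -
      (1 - Complex.I * (Real.sqrt (11 : ℝ) : ℂ)) ^ 10) • x = 0 := by
    rw [sub_smul, ← hx, ← hy, sub_self]
  exact (smul_eq_zero.mp h).resolve_left (sub_ne_zero.mpr weil11_plus_ne_minus)

/-- **`g(ψ)² = -11`** for `ψ¹¹ = 𝟙` with vanishing norm `Σ_{k<11} ψᵏ = 0`: the norm-anchor datum is a
GENUINE instance of the crux's hypothesis `φ ≫ φ = -(11 • 𝟙)` (pure algebra: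
`g = q - n = 2q + 1`, `q² = 2q + 3n`; verbatim the ideator's kernel-checked
`IdeatorTwoSketch.gaussSum_sq`, reproduced so that this file is self-contained). -/
theorem gaussSum_sq (A : AbelianVariety ℂ) (z : CategoryTheory.End A) (h11 : z ^ 11 = 1)
    (hnorm : (Finset.range 11).sum (fun k => z ^ k) = 0) :
    CategoryStruct.comp (gaussSum A z) (gaussSum A z) = -((11 : ℤ) • 𝟙 A) := by
  set q : CategoryTheory.End A := z ^ 1 + z ^ 3 + z ^ 4 + z ^ 5 + z ^ 9 with hq
  set n : CategoryTheory.End A := z ^ 2 + z ^ 6 + z ^ 7 + z ^ 8 + z ^ 10 with hn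
  have hred : ∀ m : ℕ, z ^ (11 + m) = z ^ m := fun m => by rw [pow_add, h11, one_mul]
  have h12 : z ^ 12 = z ^ 1 := hred 1
  have h13 : z ^ 13 = z ^ 2 := hred 2
  have h14 : z ^ 14 = z ^ 3 := hred 3
  have h18 : z ^ 18 = z ^ 7 := hred 7
  have hs : (Finset.range 11).sum (fun k => z ^ k) = 1 + q + n := by
    simp only [Finset.sum_range_succ, Finset.sum_range_zero, pow_zero, hq, hn]
    abel
  have hn' : n = -1 - q := by
    have h := hnorm
    rw [hs] at h
    have : n = -(1 + q) := eq_neg_of_add_eq_zero_right h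
    rw [this]; abel
  have hq2 : q * q = 2 • q + 3 • n := by
    simp only [hq, hn, mul_add, add_mul, ← pow_add, Nat.reduceAdd, h12, h13, h14, h18]
    simp only [two_smul, three_nsmul]
    abel
  have hg : gaussSum A z = 2 • q + 1 := by
    have : gaussSum A z = q - n := by
      simp only [gaussSum, hq, hn, pow_one]
      abel
    rw [this, hn']
    abel
  have hmul : CategoryStruct.comp (gaussSum A z) (gaussSum A z) = gaussSum A z * gaussSum A z := rfl
  rw [hmul, hg]
  have hexp : (2 • q + 1) * (2 • q + 1) = 4 • (q * q) + 4 • q + 1 := by noncomm_ring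
  rw [hexp, hq2, hn']
  change (4 • (2 • q + 3 • (-1 - q)) + 4 • q + 1 : CategoryTheory.End A) =
    -((11 : ℤ) • (1 : CategoryTheory.End A))
  module

/-- A norm anchor satisfies the crux's endomorphism hypothesis: `φ₀ ≫ φ₀ = -(11 • 𝟙 A₀)`. -/
theorem IsNormAnchor.comp_self {A₀ : AbelianVariety ℂ} {ψ₀ φ₀ : A₀ ⟶ A₀} {θ₀ : complexBetti A₀.X 2}
    (h : IsNormAnchor A₀ ψ₀ φ₀ θ₀) : φ₀ ≫ φ₀ = -((11 : ℤ) • 𝟙 A₀) := by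
  obtain ⟨_, h11, hnorm, hφ, _⟩ := h
  rw [hφ]
  exact gaussSum_sq A₀ _ h11 hnorm

/-- Transport of algebraicity along an isomorphism of `ℂ`-schemes onto a smooth projective one: if
`c ∈ H²ᵖ(Y(ℂ))` pulls back along `e.hom : X ≅ Y` to an algebraic class of the smooth projective `X`,
then `c` is algebraic on `Y` (`e.inv` is an open immersion; `(e.inv ≫ e.hom)^* = id`). Verbatim the
sibling line `semiregular-twin-hecke-vhc`. -/
theorem mem_algebraicClasses_of_iso {n : ℕ} {X Y : SchemeOver ℂ} (hX : IsSmoothProjective n X)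
    (e : X ≅ Y) {p : ℕ} {c : complexBetti Y (2 * p)}
    (hc : complexBetti.map e.hom (2 * p) c ∈ algebraicClasses X p) :
    c ∈ algebraicClasses Y p := by
  haveI : IsIso e.inv.left := by
    change IsIso ((Over.forget _).map e.inv); infer_instance
  haveI : IsOpenImmersion e.inv.left := IsOpenImmersion.of_isIso _
  have key := map_mem_algebraicClasses_of_isOpenImmersion hX e.inv hc
  have hid : complexBetti.map e.inv (2 * p) (complexBetti.map e.hom (2 * p) c) = c := by
    change (complexBetti.map e.hom (2 * p) ≫ complexBetti.map e.inv (2 * p)) c = c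
    rw [← complexBetti.map_comp, e.inv_hom_id, complexBetti.map_id]
    rfl
  rwa [hid] at key

/-! ## §5 The composition: the six stubs imply the crux, BY NAME (kernel-checked, no `sorry`) -/

/-- `WeilTenfoldsSqrtMinus11` from the six stubs (pure logic + the PROVED tree lemma
`mem_algebraicClasses_of_isogeny_of_mem_weilClassesOf`). Given `(A, φ)` and a rational `(5,5)` class
`c` of the literal Weil plane: `c = 0` is algebraic (`0 ∈ N⁵H¹⁰`). Otherwise STUB T puts `c` in
`weilClassesOf A φ 5 11`, so `c` witnesses Weil type; STUB 2 gives the anchored family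
`(π, s₀, s₁, (A₀, ψ₀, φ₀, θ₀), e₀, (B, ψ_B), e₁, f, g, m)` and its flat sections; STUB C a standard
Chern character `C`; STUB 3 the pure `{0,1}`-semiregular `E₀` on `A₀` with `ch₅(E₀) = a₅θ₀⁵ + u`,
`u ≠ 0`; the flat sections `w_k` through `(aₖ θ₀ᵏ)_k + u` are `chₖ(E₀)` at `s₀`, so STUB 4 (Perry)
makes `w_5(s₁)` algebraic on `X_{s₁}`; transported along `e₁` this is `u₁ + d` with `d` algebraic,
so `u₁ ≠ 0` is a rational ALGEBRAIC class of the Weil plane of `(B, ψ_B)`; STUB 1 makes every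
rational `(5,5)` Weil class of `B` algebraic; isogeny descent along `(f, g)` gives `c`. -/
theorem WeilTenfoldsSqrtMinus11_of (hT : Registered.stub_weilPlaneTyping)
    (hC : Registered.stub_chernCharacterOnBetti) (h1 : Registered.stub_oneClassSuffices)
    (h2 : Registered.stub_anchoredWeilFamilies) (h3 : Registered.stub_anchorPurePresentation)
    (h4 : Registered.stub_semiregularVariationalHodge) :
    Summit.HodgeConjecture.HodgeConjecture.Theses.HeckePrymWeil.WeilTenfoldsSqrtMinus11 := by
  intro A φ hdim hφ c hrat hhodge hweil
  by_cases hc0 : c = 0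
  · rw [hc0]
    exact Submodule.zero_mem _
  -- STUB T: the literal plane lies in the tree's Weil plane
  have hcW : c ∈ weilClassesOf A φ 5 11 := by
    obtain ⟨hP, hM⟩ := hT A φ hdim hφ
    have h := sup_le_sup hP hM hweil
    simpa only [weilClassesOf] using h
  -- STUB C: a standard Chern character theory
  obtain ⟨C⟩ := (hC : Nonempty StandardChernCharacterBetti)
  -- STUB 2: the anchored Weil family through an isogenous copy `B` of `A`
  obtain ⟨𝒳, S, π, hπ, hSq, hSi, hSs, s₀, s₁, A₀, ψ₀, φ₀, θ₀, e₀, B, ψB, e₁, f, g, m, hanchor, hBdim,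
      hψB, ⟨MB⟩, hflat, hg, hm, hfg, hsec⟩ :=
    h2 A φ hdim hφ ⟨c, hrat, hhodge, hcW, hc0⟩
  -- STUB 3: the pure semiregular object on the anchor
  obtain ⟨E₀, hE₀, hsr, a, u, hur, huW, hu0, hch, hch5⟩ := h3 C A₀ ψ₀ φ₀ θ₀ hanchor
  -- the flat sections through `(aₖ θ₀ᵏ)ₖ + u`
  obtain ⟨w, hwc, hwH, hw0, hw5, u₁, d, hu₁r, hu₁W, hu₁0, hd, hw1⟩ := hsec a u hur huW
  have key : ∀ k, w k s₀ = complexBetti.map e₀.hom (2 * k) (C.ch A₀.X E₀ k) := by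
    intro k
    by_cases hk : k = 5
    · subst hk
      rw [hw5, hch5]
    · rw [hw0 k hk, hch k hk]
  -- STUB 4: Perry — the flat section is algebraic on every fibre, in particular over `s₁`
  have halg : w 5 s₁ ∈ algebraicClasses (fiberOver π s₁) 5 :=
    h4 C 𝒳 S π hπ hSq hSi hSs w hwc hwH s₀ A₀.X e₀ E₀ hE₀ hsr key s₁ 5
  rw [hw1] at halg
  -- transport along `e₁ : X_{s₁} ≅ B` and peel off the algebraic part `d`
  have hX : u₁ + d ∈ algebraicClasses B.X 5 :=
    mem_algebraicClasses_of_iso (hπ.isSmoothProjective s₁) e₁ halg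
  have hu₁alg : u₁ ∈ algebraicClasses B.X 5 := by
    have h := Submodule.sub_mem _ hX hd
    rwa [add_sub_cancel_right] at h
  -- STUB 1 on `B`: every rational `(5,5)` Weil class of `(B, ψ_B)` is algebraic
  have hBall : ∀ c' : complexBetti B.X (2 * 5), IsRationalClass c' →
      IsOfHodgeType (2 * 5) B.X (2 * 5) 5 5 c' → c' ∈ weilClassesOf B ψB 5 11 →
        c' ∈ algebraicClasses B.X 5 :=
    h1 B ψB hBdim hψB ⟨u₁, hu₁r, hu₁W, hu₁0 hu0, hu₁alg⟩
  -- isogeny descent (tree, PROVED: van Geemen 3.6–3.7)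
  haveI : AlgebraicGeometry.Flat f.hom.hom.hom.left := hflat
  have hAsp : IsSmoothProjective 10 A.X := hdim ▸ AbelianVariety.isSmoothProjective_holds (A := A)
  have hBsp : IsSmoothProjective 10 B.X := hBdim ▸ AbelianVariety.isSmoothProjective_holds (A := B)
  exact mem_algebraicClasses_of_isogeny_of_mem_weilClassesOf hAsp hBsp MB f g hg hm hfg hBall hrat
    hhodge hcW

/-- Wiring check: the registered stubs feed `WeilTenfoldsSqrtMinus11_of` as stated. -/
example : Summit.HodgeConjecture.HodgeConjecture.Theses.HeckePrymWeil.WeilTenfoldsSqrtMinus11 :=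
  WeilTenfoldsSqrtMinus11_of stub_weilPlaneTyping stub_chernCharacterOnBetti stub_oneClassSuffices
    stub_anchoredWeilFamilies stub_anchorPurePresentation stub_semiregularVariationalHodge

/-! ## §6 Sanity: no stub is a costume of the crux -/

/-- The crux, hypothesis by hypothesis, in this file's notation (definitional). -/
example : Summit.HodgeConjecture.HodgeConjecture.Theses.HeckePrymWeil.WeilTenfoldsSqrtMinus11 ↔
    ∀ (A : AbelianVariety ℂ) (φ : A ⟶ A), A.dim = 10 → φ ≫ φ = -((11 : ℤ) • 𝟙 A) →
      ∀ c : complexBetti A.X (2 * 5), IsRationalClass c → IsOfHodgeType 10 A.X 10 5 5 c →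
        c ∈ litPlus A φ ⊔ litMinus A φ → c ∈ algebraicClasses A.X 5 :=
  Iff.rfl

/-- STUB 1 is implied by the crux restricted to the tree's typing (so it is at most as strong, and
its hypothesis — an ALGEBRAIC non-zero class — is what makes it strictly weaker: it is the standard
"one class suffices" reduction, not the crux). Checked: crux (tree typing) ⟹ `OneClassSuffices`. -/
theorem oneClassSuffices_of_treeTypedCrux
    (h : ∀ (B : AbelianVariety ℂ) (ψ : B ⟶ B), B.dim = 10 → ψ ≫ ψ = -((11 : ℤ) • 𝟙 B) →
      ∀ c : complexBetti B.X (2 * 5), IsRationalClass c → IsOfHodgeType (2 * 5) B.X (2 * 5) 5 5 c →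
        c ∈ weilClassesOf B ψ 5 11 → c ∈ algebraicClasses B.X 5) :
    OneClassSuffices :=
  fun B ψ hdim hψ _ c hr hh hw => h B ψ hdim hψ c hr hh hw

end Summit.HodgeConjecture.HodgeConjecture.Cruxes.WeilTenfoldsSqrtMinus11.QuaternionicNormAnchors

end
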